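import Summits.NavierStokesRegularity.NavierStokesRegularity.Theorems.ScenarioCensusRowA7hExtinction

/-!
# Census rows A7h / A7hb / A7hw (horizontal-valued ancient mild flows) — part 2/2: the rows, W1, the closures

* `Row_A7h`  — Type I (KNSS gauge `IsTypeIAncientMild C u`, any `C`) · NO symmetry · horizontal-valued (`u·e₃ ≡ 0`)
  ⇒ `u ≡ 0` on `t < 0`: **PROVED** `row_A7h_holds` (S1 `verticalVorticityExtinction` + `flatSliceRigidity`);
* `Row_A7hw` — the WINDOW `∀ M ∃ ε > 0`: Type I with constant `M` and planarity defect `√(−t)|u·e₃| ≤ ε` ⇒ `u ≡ 0`: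
  **PROVED** `row_A7hw_holds` (W1 `nearHorizontalCompactness` — tree KNSS compactness
  `Theorems.exists_tendsto_of_isTypeIAncientMild_seq`, zoom `Theorems.isTypeIAncientMild_zoom`, A2a
  `ScenarioCensus.row_A2a_excluded` — + `row_A7h_holds`; `ε(M)` ineffective);
* `Row_A7hb` — bounded KNSS-gauge class, no rate, horizontal-valued ⇒ constant: OPEN (the line's B1/B2 stubs are
  not re-homed); `row_A7h_of_row_A7hb`, `row_A7h_of_row_A7hw` are the lattice edges.
Census keys (namespace `…Theorems.ScenarioCensus`): `Row_A7h` / `Row_A7hw` / `Row_A7hb` BY NAME the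
`HorizontalMeter` Props, `row_A7h_excluded`, `row_A7hw_excluded`.

Part 2 of the re-homing of ns-idea-2's `line-horizontal-meter.lean` (sha16 489b734424670ea8); provenance in part 1
(`ScenarioCensusRowA7hExtinction.lean`).  Values are booked by the census lead, not by this file; NS regularity is
NOT proved; no summit statement is proved by this file.
-/

set_option linter.dupNamespace false

noncomputable section

namespace Summit.NavierStokesRegularity.NavierStokesRegularity.Theorems.ScenarioCensus.HorizontalMeter

open Set Function Filter Topology MeasureTheory
open scoped RealInnerProductSpace InnerProductSpace NNReal Laplacian
open Literature.Analysis Literature.Analysis.FluidPDE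
open Summit.NavierStokesRegularity.NavierStokesRegularity

/-! ## The typed rows -/

/-- **Row A7h (proposed)** — Type I in time (KNSS gauge, ANY constant `C`) · NO symmetry · horizontal-valued
(`u·e₃ ≡ 0`) ⇒ `u ≡ 0` on `t < 0`. -/
def Row_A7h : Prop :=
  ∀ (C : ℝ) (u : ℝ → (EuclideanSpace ℝ (Fin 3)) → (EuclideanSpace ℝ (Fin 3))), IsTypeIAncientMild C u → IsHorizontalValued u → ∀ t < 0, ∀ x, u t x = 0

/-- **Row A7hb (proposed)** — bounded KNSS-gauge ancient mild (NO rate) · NO symmetry · horizontal-valued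
⇒ `u` is one constant vector (in space and time). -/
def Row_A7hb : Prop :=
  ∀ u : ℝ → (EuclideanSpace ℝ (Fin 3)) → (EuclideanSpace ℝ (Fin 3)), IsBoundedKNSSMild u → IsHorizontalValued u → ∃ b : (EuclideanSpace ℝ (Fin 3)), ∀ t < 0, ∀ x, u t x = b

/-- **Row A7hw (proposed; the WINDOW)** — for every Type-I constant `M` there is `ε = ε(M) > 0` such that
a KNSS-gauge Type-I ancient mild field with planarity defect `sup √(−t)|u·e₃| ≤ ε` vanishes. -/
def Row_A7hw : Prop :=
  ∀ M : ℝ, ∃ ε : ℝ, 0 < ε ∧ ∀ u : ℝ → (EuclideanSpace ℝ (Fin 3)) → (EuclideanSpace ℝ (Fin 3)), IsTypeIAncientMild M u →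
    (∀ t < 0, ∀ x, Real.sqrt (-t) * |u t x 2| ≤ ε) → ∀ t < 0, ∀ x, u t x = 0

/-! ## Lattice edge -/

/-- The window contains the exact cell. -/
theorem row_A7h_of_row_A7hw (h : Row_A7hw) : Row_A7h := by
  intro C u hu hh
  obtain ⟨ε, hε, hwin⟩ := h C
  refine hwin u hu fun t ht x => ?_
  rw [hh t ht x, abs_zero, mul_zero]
  exact hε.le

/-- **W1 (crux, M) — near-horizontal compactness.**  A sequence in the KNSS class `A_M` of NONTRIVIAL
fields whose planarity defects tend to zero produces a nontrivial HORIZONTAL-VALUED element of `A_M`: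
normalise `sup √(−t)‖u_n‖ ≥ 1` (else `u_n ≡ 0` by the explicit small-constant cell A2a, tree
`row_A2a_excluded`), move a point with `√(−t_n)‖u_n(t_n,x_n)‖ ≥ ½` to `(−1, 0)` by the symmetries of the
class (tree `isTypeIAncientMild_zoom`, `isTypeIAncientMild_translate`; the defect is scale invariant),
extract with KNSS compactness (tree `exists_tendsto_of_isTypeIAncientMild_seq`), read off
`‖W(−1,0)‖ ≥ ½` and `W·e₃ ≡ 0` from pointwise convergence.  [KNSS2009 §4–§6; SereginSverak2009] -/
def NearHorizontalCompactness : Prop :=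
  ∀ (M : ℝ) (ε : ℕ → ℝ) (u : ℕ → ℝ → (EuclideanSpace ℝ (Fin 3)) → (EuclideanSpace ℝ (Fin 3))), Tendsto ε atTop (𝓝 0) →
    (∀ n, IsTypeIAncientMild M (u n)) →
    (∀ n, ∀ t < 0, ∀ x, Real.sqrt (-t) * |u n t x 2| ≤ ε n) →
    (∀ n, ∃ t < 0, ∃ x, u n t x ≠ 0) →
    ∃ v : ℝ → (EuclideanSpace ℝ (Fin 3)) → (EuclideanSpace ℝ (Fin 3)), IsTypeIAncientMild M v ∧ IsHorizontalValued v ∧ ∃ t < 0, ∃ x, v t x ≠ 0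

/-- **W1 is PROVED (REV 3)**: normalise each `uₙ` by the explicit-constant Liouville theorem A2a
(`Theorems.ScenarioCensus.row_A2a_excluded`: rate `< 1` forces `u ≡ 0`, so a non-trivial member has a
point with `√(−t)‖uₙ‖ > 1/2`), zoom + translate that point to `(−1, 0)` inside the class
(`Theorems.isTypeIAncientMild_zoom`; the defect `√(−t)|u₃|` is scale invariant), extract with the tree's
KNSS compactness theorem (`Theorems.exists_tendsto_of_isTypeIAncientMild_seq`), and read off: the limit
is non-zero at `(−1, 0)` and its third component vanishes. -/
theorem nearHorizontalCompactness : NearHorizontalCompactness := by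
  intro M ε u hε hA hwin hnz
  -- Step 1: a point where `√(−t) ‖uₙ(t,x)‖ > 1/2`, by A2a
  have hpt : ∀ n, ∃ t : ℝ, t < 0 ∧ ∃ x : (EuclideanSpace ℝ (Fin 3)), (1 / 2 : ℝ) / Real.sqrt (-t) < ‖u n t x‖ := by
    intro n
    by_contra hcon
    push Not at hcon
    have hhalf : IsTypeIAncientMild (1 / 2 : ℝ) (u n) :=
      ⟨(hA n).1, (hA n).2.1, (hA n).2.2.1, fun t ht x => hcon t ht x⟩
    obtain ⟨t, ht, x, hx⟩ := hnz n
    exact hx (Theorems.ScenarioCensus.row_A2a_excluded (1 / 2) (by norm_num) (u n) hhalf t ht x)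
  choose T hT X hX using hpt
  -- Step 2: zoom + translate the point to `(−1, 0)`
  set lam : ℕ → ℝ := fun n => Real.sqrt (-(T n)) with hlam
  have hlam0 : ∀ n, 0 < lam n := fun n => Real.sqrt_pos.2 (neg_pos.2 (hT n))
  have hlam2 : ∀ n, lam n ^ 2 = -(T n) := fun n => Real.sq_sqrt (neg_pos.2 (hT n)).le
  set v : ℕ → ℝ → (EuclideanSpace ℝ (Fin 3)) → (EuclideanSpace ℝ (Fin 3)) := fun n => lam n • stPull (lam n ^ 2) (lam n) 0 (X n) (u n) with hv
  have hvA : ∀ n, IsTypeIAncientMild M (v n) := fun n =>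
    Theorems.isTypeIAncientMild_zoom (hA n) (hlam0 n) (X n)
  have hv_apply : ∀ n s y, v n s y = lam n • u n (lam n ^ 2 * s) (X n + lam n • y) := by
    intro n s y
    simp [hv, stPull]
  -- value at `(−1, 0)`
  have hbig : ∀ n, (1 / 2 : ℝ) < ‖v n (-1) 0‖ := by
    intro n
    rw [hv_apply, smul_zero, add_zero, norm_smul, Real.norm_of_nonneg (hlam0 n).le,
      show lam n ^ 2 * (-1 : ℝ) = T n by rw [hlam2]; ring]
    have h := hX n
    rw [div_lt_iff₀ (hlam0 n)] at h
    linarith [h]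
  -- the defect is scale invariant
  have hvwin : ∀ n, ∀ s < 0, ∀ y, Real.sqrt (-s) * |v n s y 2| ≤ ε n := by
    intro n s hs y
    have hs' : lam n ^ 2 * s < 0 := mul_neg_of_pos_of_neg (pow_pos (hlam0 n) 2) hs
    have h := hwin n (lam n ^ 2 * s) hs' (X n + lam n • y)
    have e1 : Real.sqrt (-(lam n ^ 2 * s)) = lam n * Real.sqrt (-s) := by
      rw [show -(lam n ^ 2 * s) = lam n ^ 2 * (-s) by ring, Real.sqrt_mul (sq_nonneg _),
        Real.sqrt_sq (hlam0 n).le]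
    have e2 : v n s y 2 = lam n * u n (lam n ^ 2 * s) (X n + lam n • y) 2 := by
      rw [hv_apply]; simp
    rw [e2, abs_mul, abs_of_pos (hlam0 n)]
    calc Real.sqrt (-s) * (lam n * |u n (lam n ^ 2 * s) (X n + lam n • y) 2|)
        = Real.sqrt (-(lam n ^ 2 * s)) * |u n (lam n ^ 2 * s) (X n + lam n • y) 2| := by
          rw [e1]; ring
      _ ≤ ε n := h
  -- Step 3: extraction
  obtain ⟨φ, hφ, W, hW, hconv, -, -, -⟩ := Theorems.exists_tendsto_of_isTypeIAncientMild_seq M hvA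
  refine ⟨W, hW, ?_, -1, by norm_num, 0, ?_⟩
  · -- Step 4: the limit is horizontal-valued
    intro t ht x
    have hc3 : Tendsto (fun j => v (φ j) t x 2) atTop (𝓝 (W t x 2)) :=
      ((EuclideanSpace.proj (2 : Fin 3)).continuous.tendsto (W t x)).comp (hconv t ht x)
    have habs : Tendsto (fun j => |v (φ j) t x 2|) atTop (𝓝 |W t x 2|) := hc3.abs
    have hεφ : Tendsto (fun j => ε (φ j) / Real.sqrt (-t)) atTop (𝓝 (0 / Real.sqrt (-t))) :=
      (hε.comp hφ.tendsto_atTop).div_const _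
    rw [zero_div] at hεφ
    have hle : ∀ j, |v (φ j) t x 2| ≤ ε (φ j) / Real.sqrt (-t) := by
      intro j
      rw [le_div_iff₀ (Real.sqrt_pos.2 (neg_pos.2 ht)), mul_comm]
      exact hvwin (φ j) t ht x
    have h0 : |W t x 2| ≤ 0 := le_of_tendsto_of_tendsto' habs hεφ hle
    exact abs_eq_zero.1 (le_antisymm h0 (abs_nonneg _))
  · -- Step 5: the limit is non-trivial at `(−1, 0)`
    have hn : Tendsto (fun j => ‖v (φ j) (-1) 0‖) atTop (𝓝 ‖W (-1) 0‖) :=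
      (hconv (-1) (by norm_num) 0).norm
    have hge : (1 / 2 : ℝ) ≤ ‖W (-1) 0‖ :=
      ge_of_tendsto' hn fun j => (hbig (φ j)).le
    intro h0
    rw [h0, norm_zero] at hge
    norm_num at hge

/-! ## Compositions (real proofs) -/

/-- **Rung 1a**: S1 + the tree's flat-slice rigidity ⇒ Row A7h. -/
theorem row_A7h_of_stubs (hS1 : VerticalVorticityExtinction) : Row_A7h := by
  intro C u hu hh
  exact flatSliceRigidity hu hh (by norm_num : (-1 : ℝ) < 0) (hS1 C u hu hh (-1) (by norm_num))

/-- **Rung 1a CLOSED in kernel (REV 2)**: `Row_A7h` — every Type-I ancient mild solution of the KNSS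
gauge class with `u₃ ≡ 0` vanishes identically (S1 `verticalVorticityExtinction` + `flatSliceRigidity`). -/
theorem row_A7h_holds : Row_A7h := row_A7h_of_stubs verticalVorticityExtinction

/-- **Rung 2 (the window)**: W1 + Row A7h ⇒ Row A7hw (compactness–contradiction; `ε(M)` ineffective). -/
theorem row_A7hw_of_stubs (hW : NearHorizontalCompactness) (hA : Row_A7h) : Row_A7hw := by
  intro M
  by_contra hcon
  push Not at hcon
  have hε : ∀ n : ℕ, (0 : ℝ) < 1 / ((n : ℝ) + 1) := fun n => by positivity
  choose u hu hwin hne using fun n : ℕ => hcon (1 / ((n : ℝ) + 1)) (hε n)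
  obtain ⟨v, hv, hhv, t, ht, x, hx⟩ :=
    hW M (fun n => 1 / ((n : ℝ) + 1)) u (tendsto_one_div_add_atTop_nhds_zero_nat (𝕜 := ℝ)) hu hwin hne
  exact hx (hA M v hv hhv t ht x)

/-- Rung 2 from the stubs alone. -/
theorem row_A7hw_of_stubs' (hW : NearHorizontalCompactness) (hS1 : VerticalVorticityExtinction) :
    Row_A7hw :=
  row_A7hw_of_stubs hW (row_A7h_of_stubs hS1)

/-- **Row A7hb ⇒ Row A7h**: a horizontal-valued Type-I field is, after the shift, a bounded horizontal-valued
KNSS-gauge field, hence a constant `b`; the Type-I rate at `t → −∞` forces `b = 0`. -/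
theorem row_A7h_of_row_A7hb (h : Row_A7hb) : Row_A7h := by
  intro C u hu hh t ht x
  -- shift by t₀ := t/2 so that the time `t` is `t/2 + t₀`
  have ht₀ : t / 2 < 0 := by linarith
  obtain ⟨b, hb⟩ := h (fun τ => u (τ + t / 2)) (isBoundedKNSSMild_shift hu ht₀)
    (fun τ hτ y => hh (τ + t / 2) (by linarith) y)
  -- `u ≡ b` on `σ < t/2` (which contains the time `t` itself); the rate at `σ → −∞` forces `b = 0`
  have hub : ∀ σ < t / 2, ∀ y, u σ y = b := by
    intro σ hσ y
    have := hb (σ - t / 2) (by linarith) y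
    simpa using this
  have hb0 : b = 0 := by
    by_contra hne
    have hpos : 0 < ‖b‖ := norm_pos_iff.2 hne
    have hbne : ‖b‖ ≠ 0 := hpos.ne'
    set K : ℝ := C / ‖b‖ + 1 with hK
    have hK0 : 0 < K := by have := div_nonneg hu.nonneg hpos.le; linarith
    set σ : ℝ := min (t - 1) (-(K ^ 2)) with hσdef
    have hσt : σ < t / 2 := (min_le_left _ _).trans_lt (by linarith)
    have hσK : K ^ 2 ≤ -σ := by have := min_le_right (t - 1) (-(K ^ 2)); linarith
    have hsqrt : K ≤ Real.sqrt (-σ) := by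
      calc K = Real.sqrt (K ^ 2) := (Real.sqrt_sq hK0.le).symm
        _ ≤ Real.sqrt (-σ) := Real.sqrt_le_sqrt hσK
    have hσ0 : σ < 0 := by linarith
    have h1 := hu.norm_le hσ0 (0 : (EuclideanSpace ℝ (Fin 3)))
    rw [hub σ hσt 0] at h1
    have h2 : C / Real.sqrt (-σ) ≤ C / K := div_le_div_of_nonneg_left hu.nonneg hK0 hsqrt
    have h3 : C / K < ‖b‖ := by
      rw [div_lt_iff₀ hK0, hK]
      have : ‖b‖ * (C / ‖b‖ + 1) = C + ‖b‖ := by field_simp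
      linarith
    linarith
  rw [hub t (by linarith) x, hb0]

/-- **Rung 2 now rests on W1 alone (REV 2)**: `NearHorizontalCompactness → Row_A7hw`, the Type-I rung
being closed in kernel (`row_A7h_holds`). -/
theorem row_A7hw_of_W1 (hW1 : NearHorizontalCompactness) : Row_A7hw :=
  row_A7hw_of_stubs hW1 row_A7h_holds

/-- **Rung 2 CLOSED in kernel (REV 3)**: `Row_A7hw` — the near-horizontal WINDOW: for every `M` there is
`ε > 0` such that no non-trivial Type-I ancient mild solution of the KNSS gauge class has
`√(−t)|u₃| ≤ ε` everywhere (W1 `nearHorizontalCompactness` + `row_A7h_holds`). -/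
theorem row_A7hw_holds : Row_A7hw := row_A7hw_of_W1 nearHorizontalCompactness

end Summit.NavierStokesRegularity.NavierStokesRegularity.Theorems.ScenarioCensus.HorizontalMeter

namespace Summit.NavierStokesRegularity.NavierStokesRegularity.Theorems.ScenarioCensus

/-- Census row A7h — (Type I, KNSS gauge, any constant · NO symmetry · horizontal-valued `u·e₃ ≡ 0`): `u ≡ 0`,
BY NAME `HorizontalMeter.Row_A7h` (ns-idea-2 LINE «horizontal-meter», VERBATIM). Closed by `row_A7h_excluded`. -/
def Row_A7h : Prop := HorizontalMeter.Row_A7h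

/-- A7h is PROVED in the tree: `HorizontalMeter.row_A7h_holds`. -/
theorem row_A7h_excluded : Row_A7h := HorizontalMeter.row_A7h_holds

/-- Census row A7hw — the near-horizontal WINDOW (`∀ M ∃ ε > 0`, planarity defect `√(−t)|u·e₃| ≤ ε` ⇒ `u ≡ 0`),
BY NAME `HorizontalMeter.Row_A7hw` (VERBATIM). Closed by `row_A7hw_excluded`. -/
def Row_A7hw : Prop := HorizontalMeter.Row_A7hw

/-- A7hw is PROVED in the tree: `HorizontalMeter.row_A7hw_holds`. -/
theorem row_A7hw_excluded : Row_A7hw := HorizontalMeter.row_A7hw_holds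

/-- Census row A7hb — (bounded KNSS-gauge ancient mild, NO rate · NO symmetry · horizontal-valued): `u` is one
constant vector, BY NAME `HorizontalMeter.Row_A7hb` (VERBATIM). OPEN. -/
def Row_A7hb : Prop := HorizontalMeter.Row_A7hb

/-- Lattice: A7hb ⇒ A7h (`HorizontalMeter.row_A7h_of_row_A7hb`, time shift + Type-I rate). -/
theorem row_A7h_of_row_A7hb (h : Row_A7hb) : Row_A7h := HorizontalMeter.row_A7h_of_row_A7hb h

/-- Lattice: A7hw ⇒ A7h (`HorizontalMeter.row_A7h_of_row_A7hw`, the window contains the exact cell). -/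
theorem row_A7h_of_row_A7hw (h : Row_A7hw) : Row_A7h := HorizontalMeter.row_A7h_of_row_A7hw h

end Summit.NavierStokesRegularity.NavierStokesRegularity.Theorems.ScenarioCensus
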